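import Literature.AlgebraicGeometry.Frobenioids.CategoriesFactorizationRevised
import Literature.AlgebraicGeometry.Frobenioids.FiniteEtaleBaseProofs
import Literature.AlgebraicGeometry.Frobenioids.QuasiTemperoidProofs
import Literature.AlgebraicGeometry.Frobenioids.QuasiTemperoidConnectedPart
import Literature.AlgebraicGeometry.Frobenioids.BaseCategoryFSMTypeProofs
import Literature.AlgebraicGeometry.Frobenioids.FinSubextCatFSM
import HarnessLib

/-!
# Categories of FSMFF-type in the author's revised sense: the base categories of the tree

Mochizuki, *The geometry of Frobenioids I*, §0 p. 18 ("Thus, if `C` is of FSM-type, then it is of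
FSMFF-type") [cite: MochizukiFrdI2008, §0 p.18], with condition (b) of "FSMFF-type" as REVISED by
the author's *Comments on "The geometry of Frobenioids I"* (January 2024), item (28), p. 3
[cite: MochizukiFrdIComments2024, (28) p.3] — the structure `IsOfFSMFFType2024` of
`CategoriesFactorizationRevised.lean`.

Every base category which the tree proves to be of FSMFF-type does so through "FSM-type ⇒
FSMFF-type"; since that implication survives the revision (`IsOfFSMType.isOfFSMFFType2024`, with
`N = 1`), each of them is of FSMFF-type in the REVISED sense as well. This PROOF file records these
upgrades by name, so that consumers of statements carrying the revised hypothesis (the author's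
corrected [FrdI] Prop. 1.14 (iii), `IrreducibleMorphismsRevised.lean`; the corrected proof of
[FrdII] Prop. 3.4 (viii)) have them in hand:

* the connected finite étale coverings of `Spec F`, `F` a field — in particular `D₀` over `ℚ_p`
  ([FrdII] §1 p. 7) and over `ℝ` ([FrdII] §3 p. 23) [cite: MochizukiFrdII2008, §1 p.7];
* `B^temp(Π)⁰` and `B^temp(Π, Π°)⁰` for a tempered group `Π` ([FrdII] Ex. 1.3 (i), p. 11: "of
  FSM-type, hence, in particular, of FSMFF-type") — the revised counterpart
  `QuasiTemperoid.connectedPartIsOfFSMFFType2024` of the named statement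
  `QuasiTemperoid.ConnectedPartIsOfFSMFFType`, proved outright [cite: MochizukiFrdII2008, Ex 1.3 (i) p.11];
* the connected objects of a Galois category ([FrdI] Rem. 3.1.3, p. 58);
* the finite subextensions `FinSubextCat F K` of a Galois extension ([FrdI] Thm. 6.2 (iii), p. 111);
* and, a fortiori, the two NON-examples of [FrdI] Rem. 3.1.3 (the one-object category of `ℕ_{≥1}`,
  `Order(ℤ_{≥0})`) are not of FSMFF-type in the revised sense either.

PROOF-ONLY file (no new definitions); nothing here is specific to the revision beyond
`IsOfFSMType.isOfFSMFFType2024` and `IsOfFSMFFType2024.isOfFSMFFType`; no statement of the papers is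
strengthened.
-/

namespace Literature.AlgebraicGeometry.Frobenioids

open CategoryTheory Topology
open Literature.AnabelianGeometry.SemiGraphs

universe v u

/-! ### Connected finite étale coverings of the spectrum of a field -/

namespace FinEtale

/-- The category of connected finite étale coverings of `Spec F` is of FSMFF-type in the revised
(2024) sense ([FrdII] §1 p. 7 "hence also of FSMFF-type", via FSM-type).
[cite: MochizukiFrdII2008, §1 p.7] -/
theorem isOfFSMFFType2024 (F : Type u) [Field F] : IsOfFSMFFType2024 (FinEtale F) :=
  (isOfFSMType F).isOfFSMFFType2024

end FinEtale

/-- [FrdII] §1 p. 7: `D₀` (connected finite étale coverings of `Spec ℚ_p`) is of FSMFF-type — in the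
revised (2024) sense. [cite: MochizukiFrdII2008, §1 p.7] -/
theorem PadicBase.isOfFSMFFType2024 (p : ℕ) [Fact p.Prime] : IsOfFSMFFType2024 (PadicBase p) :=
  FinEtale.isOfFSMFFType2024 ℚ_[p]

/-- [FrdII] §3 p. 23: `D₀` (connected finite étale coverings of `Spec ℝ`) is of FSMFF-type — in the
revised (2024) sense. [cite: MochizukiFrdII2008, §3 p.23] -/
theorem ArchBase.isOfFSMFFType2024 : IsOfFSMFFType2024 ArchBase :=
  FinEtale.isOfFSMFFType2024 ℝ

/-! ### Connected objects of a Galois category; finite subextensions -/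

/-- [FrdI] Rem. 3.1.3, third clause (p. 58): the connected objects of a Galois category form a
category "of FSM- [hence also of FSMFF-] type" — FSMFF in the revised (2024) sense.
[cite: MochizukiFrdI2008, Rem. 3.1.3 p.58] -/
theorem connectedPart_isOfFSMFFType2024 (C : Type u) [Category.{v} C] [GaloisCategory C] :
    IsOfFSMFFType2024 (ConnectedPart C) :=
  (connectedPart_isOfFSMType C).isOfFSMFFType2024

/-- [FrdI] Thm. 6.2 (iii), proof (p. 111: "`D` is of FSM-type [hence also of FSMFF-type]") for
`D = FinSubextCat F K`, `K/F` Galois — FSMFF in the revised (2024) sense.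
[cite: MochizukiFrdI2008, Thm. 6.2 (iii) p.111] -/
theorem FinSubextCat.isOfFSMFFType2024 (F : Type u) [Field F] (K : Type u) [Field K] [Algebra F K]
    [IsGalois F K] : IsOfFSMFFType2024 (FinSubextCat F K) :=
  (FinSubextCat.isOfFSMType F K).isOfFSMFFType2024

/-! ### Tempered groups: `B^temp(Π)⁰` and `B^temp(Π, Π°)⁰` ([FrdII] Ex. 1.3 (i)) -/

namespace QuasiTemperoid

variable (G : Type u) [Group G] [TopologicalSpace G]

/-- **[FrdII] Example 1.3 (i)**, claim (p. 11) "`E⁰` is … of FSM-type, hence, in particular, of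
FSMFF-type" for `E⁰ = B^temp(Π, Π°)⁰`, PROVED OUTRIGHT with "FSMFF-type" in the author's revised
(2024) sense — the revised counterpart of the named statement `ConnectedPartIsOfFSMFFType G`
(same hypotheses, verbatim), from `connectedPartMonoIsIso_holds` ("every monomorphism of `E⁰` is an
isomorphism") and "FSM-type ⇒ FSMFF-type", which survives the revision.
[cite: MochizukiFrdII2008, Ex 1.3 (i) p.11] [cite: MochizukiFrdIComments2024, (28) p.3] -/
theorem connectedPartIsOfFSMFFType2024 :
    IsTopologicalGroup G → IsTempered G → ∀ H : Subgroup G, IsOpen (H : Set G) →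
      IsOfFSMFFType2024 (ConnectedPart (BTempRel G H)) :=
  fun i hG H hH => (isOfFSMType_of_mono_isIso (@connectedPartMonoIsIso_holds G _ _ i hG H hH)).isOfFSMFFType2024

namespace BTempConnected

variable {G}

/-- `B^temp(Π)⁰` is of FSMFF-type in the revised (2024) sense ([FrdII] Ex. 1.3, pp. 11–12, via
FSM-type). [cite: MochizukiFrdII2008, Ex 1.3 (iii) pp.11-12] -/
theorem connectedPart_isOfFSMFFType2024 : IsOfFSMFFType2024 (ConnectedPart (BTemp G)) :=
  connectedPart_isOfFSMType.isOfFSMFFType2024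

end BTempConnected

end QuasiTemperoid

/-! ### The non-examples of [FrdI] Remark 3.1.3, a fortiori -/

/-- [FrdI] Rem. 3.1.3, first clause (p. 58): the one-object category of `ℕ_{≥1}` is not of
FSMFF-type — nor in the (stronger) revised sense. [cite: MochizukiFrdI2008, Rem. 3.1.3 p.58] -/
theorem not_isOfFSMFFType2024_singleObj_pnat : ¬ IsOfFSMFFType2024 (SingleObj ℕ+) :=
  fun h => not_isOfFSMFFType_singleObj_pnat h.isOfFSMFFType

/-- [FrdI] Rem. 3.1.3, second clause (p. 58): `Order(ℤ_{≥0})` is not of FSMFF-type — nor in the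
(stronger) revised sense. [cite: MochizukiFrdI2008, Rem. 3.1.3 p.58] -/
theorem not_isOfFSMFFType2024_divOrder_nat : ¬ IsOfFSMFFType2024 (DivOrder (Multiplicative ℕ)) :=
  fun h => not_isOfFSMFFType_divOrder_nat h.isOfFSMFFType

end Literature.AlgebraicGeometry.Frobenioids
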